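import Mathlib
import Literature.Computability.Complexity.RangeAvoidance
import Literature.Computability.Complexity.SignDegreeXor
import Summits.PneNP.PneNP.Theorems.IP3ExpandingModel

/-!
# Random pure `IP₃` instances, II: the union bound (counting) — cell `pnp-ideate`, ROUND-22 item T22.2

FRONTIER range-avoidance ladder, rung F-N3 context (restricted-model combinatorics — nothing here bears on `P` vs `NP`).  The
`k = 6` analogue of `PstarExpandingCount`: `bad6 r ω` (some `≤ r` outputs read fewer than `19/4·|J|` variables),
`boundaryExpandingQ_of_not_bad6`, the threshold `v6 s = 5s − ⌈s/4⌉ = ⌊19s/4⌋`, cylinders `cyl6 J A` with the product count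
`card_cyl6`, the containment `badSet6_subset` (`5r ≤ N`), and the union bound
`card_badSet6_le : |bad| ≤ Σ_{i<r} C(m,i+1)·C(N, v6(i+1))·(v6(i+1)⁶)^{i+1}·Q^{m−(i+1)}`, `Q = |Fin 6 ↪ Fin N|`.
-/

set_option linter.dupNamespace false

open Finset Literature.Computability.Complexity
open Summit.PneNP.PneNP.Theorems.PstarSASDPLevel (BoundaryExpandingQ)
open Summit.PneNP.PneNP.Theorems.PstarSAClosure (nbhd)
open Summit.PneNP.PneNP.Theorems.IP3ExpandingModel

namespace Summit.PneNP.PneNP.Theorems.IP3ExpandingCount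

variable {N m : ℕ}

/-! ## Bad outcomes -/

/-- An outcome is BAD at radius `r` if some `≤ r` outputs read fewer than `19/4` variables each on average. -/
def bad6 (r : ℕ) (ω : Outcome6 N m) : Prop :=
  ∃ J : Finset (Fin m), J.card ≤ r ∧ ¬(19 * J.card ≤ 4 * (nbhd (inst6 ω) J).card)

/-- A good outcome gives an `(r, 7/2)`-boundary expanding instance. -/
theorem boundaryExpandingQ_of_not_bad6 (r : ℕ) (ω : Outcome6 N m) (h : ¬bad6 r ω) :
    BoundaryExpandingQ 7 2 r (inst6 ω) := by
  refine boundaryExpandingQ_of_vertexExpanding6 (inst6 ω) (fun j => (ω j).injective) r fun J hJ => ?_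
  by_contra hlt
  exact h ⟨J, hJ, hlt⟩

/-- The threshold `v6 s = 5s − ⌈s/4⌉ = ⌊19s/4⌋`. -/
def v6 (s : ℕ) : ℕ := 5 * s - (s + 3) / 4

/-- `v6 s + ⌈s/4⌉ = 5s`. -/
theorem v6_add (s : ℕ) : v6 s + (s + 3) / 4 = 5 * s := by unfold v6; omega

/-- A bad set of size `s` reads at most `v6 s` variables. -/
theorem le_v6_of_lt {s V : ℕ} (h : ¬(19 * s ≤ 4 * V)) : V ≤ v6 s := by unfold v6; omega

/-- `v6 s ≤ 5s`. -/
theorem v6_le (s : ℕ) : v6 s ≤ 5 * s := by unfold v6; omega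

/-! ## Cylinders and their size -/

/-- Outcomes whose outputs in `J` have all positions inside `A`. -/
noncomputable def cyl6 (J : Finset (Fin m)) (A : Finset (Fin N)) : Finset (Outcome6 N m) :=
  Fintype.piFinset fun j => if j ∈ J then embIn A else univ

/-- Membership in a cylinder. -/
theorem mem_cyl6 {J : Finset (Fin m)} {A : Finset (Fin N)} {ω : Outcome6 N m} :
    ω ∈ cyl6 J A ↔ ∀ j ∈ J, ω j ∈ embIn A := by
  simp only [cyl6, Fintype.mem_piFinset]
  constructor
  · intro h j hj
    have := h j
    rwa [if_pos hj] at this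
  · intro h j
    by_cases hj : j ∈ J
    · rw [if_pos hj]; exact h j hj
    · rw [if_neg hj]; exact Finset.mem_univ _

/-- **Product count**: `|cyl6 J A| = |embIn A|^{|J|} · Q^{m − |J|}`, `Q = |Fin 6 ↪ Fin N|`. -/
theorem card_cyl6 (J : Finset (Fin m)) (A : Finset (Fin N)) :
    (cyl6 J A).card = (embIn A).card ^ J.card * (Fintype.card (Fin 6 ↪ Fin N)) ^ (m - J.card) := by
  classical
  unfold cyl6
  rw [Fintype.card_piFinset]
  have h : ∀ j : Fin m, (if j ∈ J then embIn A else (univ : Finset (Fin 6 ↪ Fin N))).card =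
      if j ∈ J then (embIn A).card else Fintype.card (Fin 6 ↪ Fin N) := by
    intro j; split_ifs <;> simp
  simp_rw [h]
  rw [Finset.prod_ite, Finset.prod_const, Finset.prod_const]
  congr 2
  · rw [Finset.filter_mem_eq_inter, Finset.univ_inter]
  · rw [Finset.filter_not, Finset.filter_mem_eq_inter, Finset.univ_inter, Finset.card_univ_sdiff, Fintype.card_fin]

/-! ## The containment of the bad set -/

/-- The bad outcomes. -/
noncomputable def badSet6 (N m r : ℕ) : Finset (Outcome6 N m) := by
  classical exact univ.filter fun ω => bad6 r ω

/-- The covering family: over sizes `s = i + 1`, `i < r`, sets `J` of that size and vertex sets of size `v6 s`. -/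
noncomputable def cover6 (N m r : ℕ) : Finset (Outcome6 N m) :=
  (Finset.range r).biUnion fun i => ((univ : Finset (Fin m)).powersetCard (i + 1)).biUnion fun J =>
    ((univ : Finset (Fin N)).powersetCard (v6 (i + 1))).biUnion fun A => cyl6 J A

/-- **Containment**: if `5r ≤ N`, every bad outcome lies in the cover. -/
theorem badSet6_subset (r : ℕ) (hr : 5 * r ≤ N) : badSet6 N m r ⊆ cover6 N m r := by
  classical
  intro ω hω
  simp only [badSet6, Finset.mem_filter, Finset.mem_univ, true_and] at hω
  obtain ⟨J, hJr, hJ⟩ := hω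
  have hs : 1 ≤ J.card := by
    rw [Nat.one_le_iff_ne_zero]
    intro h0
    rw [Finset.card_eq_zero] at h0
    subst h0
    exact hJ (by simp)
  have hV : (nbhd (inst6 ω) J).card ≤ v6 J.card := le_v6_of_lt hJ
  have hvN : v6 J.card ≤ N := (v6_le _).trans (by omega)
  obtain ⟨A, hA, hmem⟩ := exists_set_of_small_nbhd6 ω J (v6 J.card) hvN hV
  simp only [cover6, Finset.mem_biUnion, Finset.mem_range, Finset.mem_powersetCard]
  refine ⟨J.card - 1, by omega, J, ⟨Finset.subset_univ _, by omega⟩, A, ⟨Finset.subset_univ _, ?_⟩, mem_cyl6.2 hmem⟩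
  rw [hA]; congr 1; omega

/-! ## The union bound -/

/-- Size of a cylinder over a set of size `v`, in `ℝ`: `≤ (v⁶)^{|J|} · Q^{m − |J|}`. -/
theorem card_cyl6_le (J : Finset (Fin m)) {A : Finset (Fin N)} {v : ℕ} (hA : A.card = v) :
    ((cyl6 J A).card : ℝ) ≤ ((v : ℝ) ^ 6) ^ J.card * (Fintype.card (Fin 6 ↪ Fin N) : ℝ) ^ (m - J.card) := by
  rw [card_cyl6]
  push_cast
  refine mul_le_mul_of_nonneg_right (pow_le_pow_left₀ (by positivity) ?_ _) (by positivity)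
  have := card_embIn_le A
  rw [hA] at this
  exact_mod_cast this

/-- **The union bound.**  If `5r ≤ N` then
`|bad| ≤ Σ_{i<r} C(m, i+1)·C(N, v6(i+1))·(v6(i+1)⁶)^{i+1}·Q^{m−(i+1)}`. -/
theorem card_badSet6_le (r : ℕ) (hr : 5 * r ≤ N) :
    ((badSet6 N m r).card : ℝ) ≤ ∑ i ∈ Finset.range r,
      (m.choose (i + 1) : ℝ) * (N.choose (v6 (i + 1)) : ℝ) * (((v6 (i + 1) : ℕ) : ℝ) ^ 6) ^ (i + 1) *
        (Fintype.card (Fin 6 ↪ Fin N) : ℝ) ^ (m - (i + 1)) := by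
  classical
  have h0 : ((badSet6 N m r).card : ℝ) ≤ ((cover6 N m r).card : ℝ) := by
    exact_mod_cast Finset.card_le_card (badSet6_subset r hr)
  refine h0.trans ?_
  unfold cover6
  refine (Nat.cast_le.2 Finset.card_biUnion_le).trans ?_
  push_cast
  refine Finset.sum_le_sum fun i _ => ?_
  refine (Nat.cast_le (α := ℝ).2 Finset.card_biUnion_le).trans ?_
  push_cast
  have hJ : ∀ J ∈ (univ : Finset (Fin m)).powersetCard (i + 1),
      ((((univ : Finset (Fin N)).powersetCard (v6 (i + 1))).biUnion fun A => cyl6 J A).card : ℝ) ≤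
        (N.choose (v6 (i + 1)) : ℝ) * (((v6 (i + 1) : ℕ) : ℝ) ^ 6) ^ (i + 1) *
          (Fintype.card (Fin 6 ↪ Fin N) : ℝ) ^ (m - (i + 1)) := by
    intro J hJ
    rw [Finset.mem_powersetCard] at hJ
    refine (Nat.cast_le (α := ℝ).2 Finset.card_biUnion_le).trans ?_
    push_cast
    have hterm : ∀ A ∈ (univ : Finset (Fin N)).powersetCard (v6 (i + 1)), ((cyl6 J A).card : ℝ) ≤
        (((v6 (i + 1) : ℕ) : ℝ) ^ 6) ^ (i + 1) * (Fintype.card (Fin 6 ↪ Fin N) : ℝ) ^ (m - (i + 1)) := by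
      intro A hA
      rw [Finset.mem_powersetCard] at hA
      have := card_cyl6_le (m := m) J hA.2
      rwa [hJ.2] at this
    refine (Finset.sum_le_sum hterm).trans ?_
    rw [Finset.sum_const, nsmul_eq_mul, Finset.card_powersetCard, Finset.card_univ, Fintype.card_fin]
    exact le_of_eq (by ring)
  refine (Finset.sum_le_sum hJ).trans ?_
  have hc : ((univ : Finset (Fin m)).powersetCard (i + 1)).card = m.choose (i + 1) := by
    rw [Finset.card_powersetCard, Finset.card_univ, Fintype.card_fin]
  rw [Finset.sum_const, nsmul_eq_mul, hc]
  exact le_of_eq (by ring)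

end Summit.PneNP.PneNP.Theorems.IP3ExpandingCount
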